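import Summits.CriticalPhenomena.SAWScalingLimit.Theorems.SAWDevelopingMapObservableToSLETypeLadderCarvedReductionSqueezeProb
import Summits.CriticalPhenomena.SAWScalingLimit.Theorems.SAWDefectDecoherenceObservableToSLERCarvedReductionSqueezePinning
import Summits.CriticalPhenomena.SAWScalingLimit.Theorems.SAWDefectDecoherenceObservableToSLERClassZeroAudit
import Summits.CriticalPhenomena.SAWScalingLimit.Theorems.SAWDefectDecoherenceObservableToSLERNestedTransferCells
import Summits.CriticalPhenomena.SAWScalingLimit.Theorems.SAWDevelopingMapObservableToSLETypeLadderCarvedReductionCell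
import Summits.CriticalPhenomena.SAWScalingLimit.Theorems.SAWDevelopingMapObservableToSLETypeLadderCarvedReductionSplice
import Summits.CriticalPhenomena.SAWScalingLimit.Theorems.SAWDefectDecoherenceObservableToSLERTwoPieceAdmIdentificationMesh
import HarnessLib

/-!
# SELECTION AND PINNING along a sequence of realised cells (piece (T-A sel) of stub T-A
# `stub_carvedReduction_squeezeGeometry`)

Crux `SAWDevelopingMap.ObservableToSLE` (stmt-CriticalPhenomena-10472), line `six-class-type-ladder`,
stub T-A `stub_carvedReduction_squeezeGeometry`.  Landing target:
`Summits/CriticalPhenomena/SAWScalingLimit/Theorems/SAWDevelopingMapObservableToSLETypeLadderCarvedReductionSqueezeSelection.lean`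
(`--supports stmt-CriticalPhenomena-10472`).

STAGE 1a of T-A: the LATTICE facts of the pinned frame that do not depend on the continuum
construction.  From the hypotheses of the squeeze (tame nested class-zero families, realised first
good gates) and a subsequence `φ`, for `R ≤ R₀(D, a, b)`:
* every realised gate `q_k` (`q'_k`) is an UP-FACE whose down-face lies in the level, a vertex of
  `Ω_δ`, within `R + δ_k` of the rescaled root, carrying a closed window ball inside `D`, and inside
  the window ball the removed set `S_k(n_k) ∪ T_k(n'_k)` is EXACTLY the rows below the gate row
  (class-zero dictionary `BridgeGate.classZero_gate_eq`, far level excluded by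
  `BridgeGate.window_disjoint_far_level` once `8R ≤ dist (pt 0, pt 1)`) — `realisedGate_facts`;
* along a sub-subsequence `ψ₀` the meshes decrease strictly (`TypeLadder.exists_strictAnti_subseq`),
  the rescaled gates converge (Bolzano–Weierstrass), and ONE lattice translation `x_j` per index
  pins both gate rows strictly above the heights of the limit gate points `P₀`, `P₁` of the pinned
  frame at every index (twin piece `Squeeze.stub_carvedReduction_pinning`, p133120);
* the carved laws are probability measures eventually (`TypeLadder.eventually_isProbabilityMeasure_carvedLaw`,
  p134516).
Main statement: `carvedReduction_squeezeGeometry_selection`; registered carrier: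
`stub_carvedReduction_isBounded_of_eventually`.
-/

noncomputable section

open scoped BigOperators Topology NNReal ENNReal Classical
open Filter Set MeasureTheory Metric
open Literature.Probability.LatticeModels (HexVertex hexGraph hexCenter triZeta triEmbed Site polyline)
open Literature.Probability.RandomPlanarGeometry
open Literature.Probability.RandomPlanarGeometry.SAW

namespace Summit.CriticalPhenomena.SAWScalingLimit.Theorems.ObservableToSLE.TypeLadder

open Summit.CriticalPhenomena.SAWScalingLimit.Theorems.ObservableToSLER.BridgeGate
open Summit.CriticalPhenomena.SAWScalingLimit.Theorems.ObservableToSLER.NestedGate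
open Summit.CriticalPhenomena.SAWScalingLimit.Theorems.ObservableToSLER.Squeeze (stub_carvedReduction_pinning)
open Summit.CriticalPhenomena.SAWScalingLimit.Theorems.ObservableToSLER.TwoPiece (dist_smul_hexCenter_le_of_adj)

/-! ### One realised gate -/

/-- **The lattice facts of one realised class-zero gate.**  At a realised first good gate `(n; m, p, q)`
of a tame class-zero family `S` (root `a`) for a walk `γ` of `Ω_δ`: `q = (q.1, 0)` is an up-face with
`p = (q.1 - e₁, 1) ∈ S n` below it, `q` is a vertex of `Ω_δ`, `dist (δ c_q, δ c_a) ≤ R + δ`, the closed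
window ball lies in `Ω`, and inside the window ball membership in `S n` is exactly `row < row q`. -/
theorem realisedGate_facts {Ω : Set ℂ} {δ ρ R : ℝ} {N : ℕ} {S : ℕ → Set HexVertex} {a u v q p : HexVertex}
    {n m : ℕ}
    (hCZ : ∀ (i : ℕ) (p q : HexVertex), HasCleanWindow Ω δ ρ (S i) p q →
      rowOf 0 q = rowOf 0 p + 1 ∧
        ∀ x : HexVertex, (δ : ℂ) * hexCenter x ∈ ball ((δ : ℂ) * hexCenter q) ρ → (x ∈ S i ↔ rowOf 0 x ≤ rowOf 0 p))
    (hS : TameNestedFamily δ R N a S) (w : (hexDomainGraph Ω δ).Walk u v) (hu : u ∈ S n)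
    (hg : IsFirstGoodGateN Ω δ ρ R S a w.support n m p q) :
    q = ((q.1, 0) : HexVertex) ∧ p = ((q.1 - Pi.single 1 1, 1) : HexVertex) ∧ p ∈ S n ∧ q ∉ S n ∧
      q ∈ embMeshDomain hexGraph hexCenter Ω δ ∧
      (0 ≤ δ → dist ((δ : ℂ) * hexCenter q) ((δ : ℂ) * hexCenter a) ≤ R + δ) ∧
      closedBall ((δ : ℂ) * hexCenter q) ρ ⊆ Ω ∧
      ∀ x : HexVertex, (δ : ℂ) * hexCenter x ∈ ball ((δ : ℂ) * hexCenter q) ρ → (x ∈ S n ↔ x.1 1 < q.1 1) := by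
  obtain ⟨⟨hexit, -, hwin, -⟩, -⟩ := hg
  obtain ⟨hrow, hexact⟩ := hCZ n p q hwin
  have hadj : hexGraph.Adj q p :=
    (embDomainGraph_le hexGraph hexCenter Ω δ (hexit.adj w)).symm
  obtain ⟨hq, hp⟩ := classZero_gate_eq hadj hrow
  have hpS : p ∈ S n := hexit.fst_mem_set
  have hqS : q ∉ S n := hexit.2.2.2
  have hqu : q ≠ u := fun h => hqS (h ▸ hu)
  have hqsupp : q ∈ w.support := List.mem_of_mem_drop hexit.snd_mem_drop
  refine ⟨hq, hp, hpS, hqS, mem_embMeshDomain_of_mem_support_of_ne w hqsupp hqu, fun hδ => ?_, hwin.1,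
    fun x hx => ?_⟩
  · calc dist ((δ : ℂ) * hexCenter q) ((δ : ℂ) * hexCenter a)
        ≤ dist ((δ : ℂ) * hexCenter q) ((δ : ℂ) * hexCenter p) + dist ((δ : ℂ) * hexCenter p) ((δ : ℂ) * hexCenter a) :=
          dist_triangle _ _ _
      _ ≤ δ + R := add_le_add (dist_smul_hexCenter_le_of_adj hδ hadj) (tame_local hS n p hpS)
      _ = R + δ := add_comm _ _
  · rw [hexact x hx]
    have h1 : rowOf 0 q = q.1 1 := rowOf_zero q
    have h2 : rowOf 0 x = x.1 1 := rowOf_zero x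
    rw [h2]; constructor <;> intro h <;> omega

/-- A sequence of points eventually in a bounded set has a convergent subsequence (Bolzano–Weierstrass). -/
theorem exists_subseq_tendsto_of_eventually {u : ℕ → ℂ} {c : ℂ} {r : ℝ}
    (h : ∀ᶠ k in atTop, u k ∈ closedBall c r) :
    ∃ (g : ℂ) (ψ : ℕ → ℕ), StrictMono ψ ∧ Tendsto (u ∘ ψ) atTop (𝓝 g) := by
  obtain ⟨g, -, ψ, hψ, hlim⟩ := tendsto_subseq_of_frequently_bounded (isBounded_closedBall (x := c) (r := r))
    h.frequently
  exact ⟨g, ψ, hψ, hlim⟩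

/-- **Registered sub-goal `stub_carvedReduction_isBounded_of_eventually`** (crux item
stmt-CriticalPhenomena-10472, stub T-A `stub_carvedReduction_squeezeGeometry`, piece (T-A sel)):
registry form of `exists_subseq_tendsto_of_eventually`. -/
theorem stub_carvedReduction_isBounded_of_eventually :
    ∀ (u : ℕ → ℂ) (c : ℂ) (r : ℝ), (∀ᶠ k in atTop, u k ∈ closedBall c r) →
      ∃ (g : ℂ) (ψ : ℕ → ℕ), StrictMono ψ ∧ Tendsto (u ∘ ψ) atTop (𝓝 g) :=
  fun _ _ _ h => exists_subseq_tendsto_of_eventually h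

/-! ### Stage 1a -/

/-- **STAGE 1a OF T-A (selection and pinning)**; see the module docstring.  Output, for
`R ≤ R₀(D, a, b)` and a subsequence `φ`: a sub-subsequence `ψ₀`, translations `x_j`, the drift limit
`τ` and the pinned limit gate points `P₀`, `P₁`, with: strictly decreasing positive meshes `→ 0⁺`;
`s_j · triEmbed x_j → τ`; all realised gates are up-faces; the pinned gates converge to `P₀`, `P₁`
and sit strictly above their heights at every index; the original gates converge to `P_i + τ`;
eventually the removed set is exact (rows below the gate row) in the `ρ/2`-balls about `P_i + τ_j`,
and the closed `ρ/2`-balls about `P_i + τ_j` lie in `D`; every gate is a vertex of `Ω_δ`; the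
carved laws are eventually probability measures. -/
theorem carvedReduction_squeezeGeometry_selection :
    ∀ (D : DobrushinDomain) (a b : ℝ → HexVertex), IsEmbEndpointApprox hexGraph hexCenter D a b →
      ∃ R₀ > (0 : ℝ), ∀ R ∈ Set.Ioc (0 : ℝ) R₀, ∀ ρ > (0 : ℝ), ∀ N : ℕ,
          ∀ (δ : ℕ → ℝ) (S T : ℕ → ℕ → Set HexVertex) (n n' : ℕ → ℕ) (q q' : ℕ → HexVertex),
            Tendsto δ atTop (𝓝[>] 0) →
            (∀ k, TameNestedFamily (δ k) R N (a (δ k)) (S k) ∧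
              TameNestedFamily (δ k) R N (b (δ k)) (T k) ∧
              (((∀ i, ExteriorAnchored D.carrier (δ k) (S k i) (a (δ k))) ∧
          (∀ i, ExteriorAnchored D.carrier (δ k) (T k i) (b (δ k))) ∧
          (∀ (i : ℕ) (p q : HexVertex), HasCleanWindow D.carrier (δ k) ρ (S k i) p q →
            rowOf 0 q = rowOf 0 p + 1 ∧
              ∀ x : HexVertex, ((δ k : ℝ) : ℂ) * hexCenter x ∈ ball (((δ k : ℝ) : ℂ) * hexCenter q) ρ →
                (x ∈ S k i ↔ rowOf 0 x ≤ rowOf 0 p)) ∧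
          (∀ (i : ℕ) (p q : HexVertex), HasCleanWindow D.carrier (δ k) ρ (T k i) p q →
            rowOf 0 q = rowOf 0 p + 1 ∧
              ∀ x : HexVertex, ((δ k : ℝ) : ℂ) * hexCenter x ∈ ball (((δ k : ℝ) : ℂ) * hexCenter q) ρ →
                (x ∈ T k i ↔ rowOf 0 x ≤ rowOf 0 p))) ∧
          (∀ (i : ℕ) (p q : HexVertex), HasCleanWindow D.carrier (δ k) ρ (S k i) p q →
            ∃ K : Set ℂ, IsCompact K ∧ IsConnected K ∧
              ((δ k : ℝ) : ℂ) * hexCenter q - ((ρ / 2 : ℝ) : ℂ) * Complex.I ∈ K ∧ ((δ k : ℝ) : ℂ) * hexCenter (a (δ k)) ∈ K ∧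
              ∀ v : HexVertex, Metric.infDist (((δ k : ℝ) : ℂ) * hexCenter v) K ≤ ρ / 4 → v ∈ S k i) ∧
          (∀ (i : ℕ) (p q : HexVertex), HasCleanWindow D.carrier (δ k) ρ (T k i) p q →
            ∃ K : Set ℂ, IsCompact K ∧ IsConnected K ∧
              ((δ k : ℝ) : ℂ) * hexCenter q - ((ρ / 2 : ℝ) : ℂ) * Complex.I ∈ K ∧ ((δ k : ℝ) : ℂ) * hexCenter (b (δ k)) ∈ K ∧
              ∀ v : HexVertex, Metric.infDist (((δ k : ℝ) : ℂ) * hexCenter v) K ≤ ρ / 4 → v ∈ T k i) ∧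
          (∀ i : ℕ, ∃ K : Set ℂ, IsCompact K ∧ IsConnected K ∧ ((δ k : ℝ) : ℂ) * hexCenter (a (δ k)) ∈ K ∧
            (∀ v : HexVertex, Metric.infDist (((δ k : ℝ) : ℂ) * hexCenter v) K ≤ ρ / 8 → v ∈ S k i) ∧
            (∀ v ∈ S k i, ∃ (t w : HexVertex) (r : ℕ), v ∈ hexBall t r ∧ w ∈ hexBall t r ∧
              hexBall t r ⊆ S k i ∧ Metric.infDist (((δ k : ℝ) : ℂ) * hexCenter w) K ≤ ρ / 16)) ∧
          (∀ i : ℕ, ∃ K : Set ℂ, IsCompact K ∧ IsConnected K ∧ ((δ k : ℝ) : ℂ) * hexCenter (b (δ k)) ∈ K ∧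
            (∀ v : HexVertex, Metric.infDist (((δ k : ℝ) : ℂ) * hexCenter v) K ≤ ρ / 8 → v ∈ T k i) ∧
            (∀ v ∈ T k i, ∃ (t w : HexVertex) (r : ℕ), v ∈ hexBall t r ∧ w ∈ hexBall t r ∧
              hexBall t r ⊆ T k i ∧ Metric.infDist (((δ k : ℝ) : ℂ) * hexCenter w) K ≤ ρ / 16)))) →
            (∀ k, ∃ (γ : HexDomainSAW D.carrier (δ k) (a (δ k)) (b (δ k))) (m : ℕ) (p : HexVertex)
                (m' : ℕ) (p' : HexVertex),
              IsFirstGoodGateN D.carrier (δ k) ρ R (S k) (a (δ k)) γ.walk.support (n k) m p (q k) ∧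
              IsFirstGoodGateN D.carrier (δ k) ρ R (T k) (b (δ k)) γ.walk.support.reverse
                (n' k) m' p' (q' k) ∧
              WideLink D.carrier (δ k) ρ (S k (n k) ∪ T k (n' k)) (q k) (q' k)) →
            ∀ φ : ℕ → ℕ, StrictMono φ →
              ∃ (ψ₀ : ℕ → ℕ) (x : ℕ → Site 2) (τ P₀ P₁ : ℂ),
                StrictMono ψ₀ ∧ (StrictAnti fun j => δ (φ (ψ₀ j))) ∧ (∀ j, 0 < δ (φ (ψ₀ j))) ∧
                Tendsto (fun j => δ (φ (ψ₀ j))) atTop (𝓝[>] 0) ∧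
                Tendsto (fun j => ((δ (φ (ψ₀ j)) : ℝ) : ℂ) * triEmbed (x j)) atTop (𝓝 τ) ∧
                (∀ k, (q k).2 = 0) ∧ (∀ k, (q' k).2 = 0) ∧
                Tendsto (fun j => ((δ (φ (ψ₀ j)) : ℝ) : ℂ) *
                  hexCenter (((q (φ (ψ₀ j))).1 - x j, 0) : HexVertex)) atTop (𝓝 P₀) ∧
                Tendsto (fun j => ((δ (φ (ψ₀ j)) : ℝ) : ℂ) *
                  hexCenter (((q' (φ (ψ₀ j))).1 - x j, 0) : HexVertex)) atTop (𝓝 P₁) ∧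
                (∀ j, P₀.im < (((δ (φ (ψ₀ j)) : ℝ) : ℂ) * hexCenter (((q (φ (ψ₀ j))).1 - x j, 0) : HexVertex)).im) ∧
                (∀ j, P₁.im < (((δ (φ (ψ₀ j)) : ℝ) : ℂ) * hexCenter (((q' (φ (ψ₀ j))).1 - x j, 0) : HexVertex)).im) ∧
                Tendsto (fun j => ((δ (φ (ψ₀ j)) : ℝ) : ℂ) * hexCenter (q (φ (ψ₀ j)))) atTop (𝓝 (P₀ + τ)) ∧
                Tendsto (fun j => ((δ (φ (ψ₀ j)) : ℝ) : ℂ) * hexCenter (q' (φ (ψ₀ j)))) atTop (𝓝 (P₁ + τ)) ∧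
                (∀ᶠ j in atTop, ∀ v : HexVertex,
                  ((δ (φ (ψ₀ j)) : ℝ) : ℂ) * hexCenter v - ((δ (φ (ψ₀ j)) : ℝ) : ℂ) * triEmbed (x j) ∈ ball P₀ (ρ / 2) →
                    (v ∈ S (φ (ψ₀ j)) (n (φ (ψ₀ j))) ∪ T (φ (ψ₀ j)) (n' (φ (ψ₀ j))) ↔
                      v.1 1 < (q (φ (ψ₀ j))).1 1)) ∧
                (∀ᶠ j in atTop, ∀ v : HexVertex,
                  ((δ (φ (ψ₀ j)) : ℝ) : ℂ) * hexCenter v - ((δ (φ (ψ₀ j)) : ℝ) : ℂ) * triEmbed (x j) ∈ ball P₁ (ρ / 2) →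
                    (v ∈ S (φ (ψ₀ j)) (n (φ (ψ₀ j))) ∪ T (φ (ψ₀ j)) (n' (φ (ψ₀ j))) ↔
                      v.1 1 < (q' (φ (ψ₀ j))).1 1)) ∧
                (∀ᶠ j in atTop,
                  closedBall (P₀ + ((δ (φ (ψ₀ j)) : ℝ) : ℂ) * triEmbed (x j)) (ρ / 2) ⊆ D.carrier ∧
                  closedBall (P₁ + ((δ (φ (ψ₀ j)) : ℝ) : ℂ) * triEmbed (x j)) (ρ / 2) ⊆ D.carrier) ∧
                (∀ k, q k ∈ embMeshDomain hexGraph hexCenter D.carrier (δ k)) ∧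
                (∀ᶠ k in atTop, IsProbabilityMeasure
                  (carvedLaw D.carrier (δ k) (S k (n k) ∪ T k (n' k)) (q k) (q' k))) := by
  intro D a b hab
  -- the scales
  obtain ⟨R₁, hR₁, hprob⟩ := eventually_isProbabilityMeasure_carvedLaw D a b hab
  have hL : 0 < dist (D.pt 0) (D.pt 1) := dist_pos.2 fun h => absurd (D.pt_injective h) (by decide)
  set L : ℝ := dist (D.pt 0) (D.pt 1) with hLdef
  refine ⟨min R₁ (L / 8), lt_min hR₁ (by positivity), ?_⟩
  intro R hR ρ hρ N δ S T n n' q q' hδ hfam hgates φ hφ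
  have hRR₁ : R ∈ Set.Ioc 0 R₁ := ⟨hR.1, hR.2.trans (min_le_left _ _)⟩
  have hRL : 8 * R ≤ L := by linarith [hR.2.trans (min_le_right _ _)]
  have hδpos : ∀ᶠ k in atTop, 0 < δ k := hδ.eventually self_mem_nhdsWithin
  have hδ0 : Tendsto δ atTop (𝓝 0) := tendsto_nhds_of_tendsto_nhdsWithin hδ
  have hpt : ∀ i, D.pt i ∉ D.carrier := fun i => by
    have h := (D.pt_mem_frontier i).2
    rwa [D.isOpen.interior_eq] at h
  -- per-index facts
  have hfacts : ∀ k,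
      (q k = (((q k).1, 0) : HexVertex) ∧ q k ∈ embMeshDomain hexGraph hexCenter D.carrier (δ k) ∧
        (0 ≤ δ k → dist ((δ k : ℂ) * hexCenter (q k)) ((δ k : ℂ) * hexCenter (a (δ k))) ≤ R + δ k) ∧
        closedBall ((δ k : ℂ) * hexCenter (q k)) ρ ⊆ D.carrier ∧
        ∀ x : HexVertex, (δ k : ℂ) * hexCenter x ∈ ball ((δ k : ℂ) * hexCenter (q k)) ρ →
          (x ∈ S k (n k) ↔ x.1 1 < (q k).1 1)) ∧
      (q' k = (((q' k).1, 0) : HexVertex) ∧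
        (0 ≤ δ k → dist ((δ k : ℂ) * hexCenter (q' k)) ((δ k : ℂ) * hexCenter (b (δ k))) ≤ R + δ k) ∧
        closedBall ((δ k : ℂ) * hexCenter (q' k)) ρ ⊆ D.carrier ∧
        ∀ x : HexVertex, (δ k : ℂ) * hexCenter x ∈ ball ((δ k : ℂ) * hexCenter (q' k)) ρ →
          (x ∈ T k (n' k) ↔ x.1 1 < (q' k).1 1)) := by
    intro k
    obtain ⟨hS, hT, ⟨-, -, hCZS, hCZT⟩, -⟩ := hfam k
    obtain ⟨γ, m, p, m', p', hgS, hgT, -⟩ := hgates k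
    obtain ⟨hq, -, -, -, hqdom, hdist, hwin, hex⟩ := realisedGate_facts hCZS hS γ.walk (hS.2.1 (n k)) hgS
    have hgT' : IsFirstGoodGateN D.carrier (δ k) ρ R (T k) (b (δ k)) γ.walk.reverse.support (n' k) m' p' (q' k) := by
      rw [SimpleGraph.Walk.support_reverse]; exact hgT
    obtain ⟨hq', -, -, -, -, hdist', hwin', hex'⟩ :=
      realisedGate_facts hCZT hT γ.walk.reverse (hT.2.1 (n' k)) hgT'
    exact ⟨⟨hq, hqdom, hdist, hwin, hex⟩, hq', hdist', hwin', hex'⟩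
  -- the rescaled roots and gates converge / stay bounded
  have ha : Tendsto (fun k => (δ k : ℂ) * hexCenter (a (δ k))) atTop (𝓝 (D.pt 0)) := hab.tendsto_fst.comp hδ
  have hb : Tendsto (fun k => (δ k : ℂ) * hexCenter (b (δ k))) atTop (𝓝 (D.pt 1)) := hab.tendsto_snd.comp hδ
  have hsmall : ∀ᶠ k in atTop, δ k < R := (tendsto_order.1 hδ0).2 R hR.1
  have haR : ∀ᶠ k in atTop, dist ((δ k : ℂ) * hexCenter (a (δ k))) (D.pt 0) < R :=
    (tendsto_iff_dist_tendsto_zero.1 ha).eventually (gt_mem_nhds hR.1)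
  have hbR : ∀ᶠ k in atTop, dist ((δ k : ℂ) * hexCenter (b (δ k))) (D.pt 1) < R :=
    (tendsto_iff_dist_tendsto_zero.1 hb).eventually (gt_mem_nhds hR.1)
  have hqnear : ∀ᶠ k in atTop, (δ k : ℂ) * hexCenter (q k) ∈ closedBall (D.pt 0) (3 * R) ∧
      (δ k : ℂ) * hexCenter (q' k) ∈ closedBall (D.pt 1) (3 * R) := by
    filter_upwards [hδpos, hsmall, haR, hbR] with k hk hkR haRk hbRk
    obtain ⟨⟨-, -, hdist, -, -⟩, -, hdist', -, -⟩ := hfacts k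
    constructor
    · rw [mem_closedBall]
      linarith [dist_triangle ((δ k : ℂ) * hexCenter (q k)) ((δ k : ℂ) * hexCenter (a (δ k))) (D.pt 0),
        hdist hk.le]
    · rw [mem_closedBall]
      linarith [dist_triangle ((δ k : ℂ) * hexCenter (q' k)) ((δ k : ℂ) * hexCenter (b (δ k))) (D.pt 1),
        hdist' hk.le]
  -- exactness of the removed set in the window balls (the far level does not intrude)
  have hexactU : ∀ᶠ k in atTop,
      (∀ x : HexVertex, (δ k : ℂ) * hexCenter x ∈ ball ((δ k : ℂ) * hexCenter (q k)) ρ →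
        (x ∈ S k (n k) ∪ T k (n' k) ↔ x.1 1 < (q k).1 1)) ∧
      (∀ x : HexVertex, (δ k : ℂ) * hexCenter x ∈ ball ((δ k : ℂ) * hexCenter (q' k)) ρ →
        (x ∈ S k (n k) ∪ T k (n' k) ↔ x.1 1 < (q' k).1 1)) := by
    filter_upwards [hδpos, hsmall, haR, hbR] with k hk hkR haRk hbRk
    obtain ⟨hS, hT, -, -⟩ := hfam k
    obtain ⟨⟨-, -, hdist, hwin, hex⟩, -, hdist', hwin', hex'⟩ := hfacts k
    -- the window radius is at most the distance to the marked point
    have hρ0 : ρ < dist ((δ k : ℂ) * hexCenter (q k)) (D.pt 0) := by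
      by_contra hle; push Not at hle
      exact hpt 0 (hwin (mem_closedBall'.2 hle))
    have hρ1 : ρ < dist ((δ k : ℂ) * hexCenter (q' k)) (D.pt 1) := by
      by_contra hle; push Not at hle
      exact hpt 1 (hwin' (mem_closedBall'.2 hle))
    have hρR : ρ < 3 * R := by
      linarith [dist_triangle ((δ k : ℂ) * hexCenter (q k)) ((δ k : ℂ) * hexCenter (a (δ k))) (D.pt 0),
        hdist hk.le]
    -- the far roots are far from the windows
    have hfar0 : R + ρ ≤ dist ((δ k : ℂ) * hexCenter (q k)) ((δ k : ℂ) * hexCenter (b (δ k))) := by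
      have h1 := dist_triangle (D.pt 0) ((δ k : ℂ) * hexCenter (q k)) (D.pt 1)
      have h1' : dist (D.pt 0) ((δ k : ℂ) * hexCenter (q k)) = dist ((δ k : ℂ) * hexCenter (q k)) (D.pt 0) :=
        dist_comm _ _
      have h2 := dist_triangle ((δ k : ℂ) * hexCenter (q k)) ((δ k : ℂ) * hexCenter (b (δ k))) (D.pt 1)
      have h3 := dist_triangle ((δ k : ℂ) * hexCenter (q k)) ((δ k : ℂ) * hexCenter (a (δ k))) (D.pt 0)
      have h4 := hdist hk.le
      linarith
    have hfar1 : R + ρ ≤ dist ((δ k : ℂ) * hexCenter (q' k)) ((δ k : ℂ) * hexCenter (a (δ k))) := by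
      have g1 := dist_triangle (D.pt 0) ((δ k : ℂ) * hexCenter (a (δ k))) (D.pt 1)
      have g1' : dist (D.pt 0) ((δ k : ℂ) * hexCenter (a (δ k))) = dist ((δ k : ℂ) * hexCenter (a (δ k))) (D.pt 0) :=
        dist_comm _ _
      have g2 := dist_triangle ((δ k : ℂ) * hexCenter (a (δ k))) ((δ k : ℂ) * hexCenter (q' k)) (D.pt 1)
      have g2' : dist ((δ k : ℂ) * hexCenter (a (δ k))) ((δ k : ℂ) * hexCenter (q' k)) =
          dist ((δ k : ℂ) * hexCenter (q' k)) ((δ k : ℂ) * hexCenter (a (δ k))) := dist_comm _ _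
      have g3 := dist_triangle ((δ k : ℂ) * hexCenter (q' k)) ((δ k : ℂ) * hexCenter (b (δ k))) (D.pt 1)
      have g4 := hdist' hk.le
      linarith
    constructor
    · intro x hx
      rw [Set.mem_union, hex x hx]
      have := window_disjoint_far_level hT (n' k) hfar0 x hx
      tauto
    · intro x hx
      rw [Set.mem_union, hex' x hx]
      have := window_disjoint_far_level hS (n k) hfar1 x hx
      tauto
  -- SELECTION: strictly decreasing meshes along `φ`
  obtain ⟨ψ₁, hψ₁, hanti₁, hpos₁⟩ := exists_strictAnti_subseq (s := δ ∘ φ) (hδ.comp hφ.tendsto_atTop)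
  -- convergent gates (Bolzano–Weierstrass twice)
  obtain ⟨g₀, ψ₂, hψ₂, hlim₂⟩ := exists_subseq_tendsto_of_eventually
    (u := fun j => (δ (φ (ψ₁ j)) : ℂ) * hexCenter (q (φ (ψ₁ j)))) (c := D.pt 0) (r := 3 * R)
    (((hφ.comp hψ₁).tendsto_atTop.eventually hqnear).mono fun j h => h.1)
  obtain ⟨g₁, ψ₃, hψ₃, hlim₃⟩ := exists_subseq_tendsto_of_eventually
    (u := fun j => (δ (φ (ψ₁ (ψ₂ j))) : ℂ) * hexCenter (q' (φ (ψ₁ (ψ₂ j))))) (c := D.pt 1) (r := 3 * R)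
    ((((hφ.comp hψ₁).comp hψ₂).tendsto_atTop.eventually hqnear).mono fun j h => h.2)
  set ψ₀ : ℕ → ℕ := fun j => ψ₁ (ψ₂ (ψ₃ j)) with hψ₀def
  have hψ₀ : StrictMono ψ₀ := hψ₁.comp (hψ₂.comp hψ₃)
  have hκ : Tendsto (fun j => φ (ψ₀ j)) atTop atTop := (hφ.comp hψ₀).tendsto_atTop
  have hanti : StrictAnti fun j => δ (φ (ψ₀ j)) := hanti₁.comp_strictMono (hψ₂.comp hψ₃)
  have hspos : ∀ j, 0 < δ (φ (ψ₀ j)) := fun j => hpos₁ _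
  have hs : Tendsto (fun j => δ (φ (ψ₀ j))) atTop (𝓝[>] 0) := hδ.comp hκ
  have hs0' : Tendsto (fun j => δ (φ (ψ₀ j))) atTop (𝓝 0) := hδ0.comp hκ
  have hgate0 : Tendsto (fun j => (δ (φ (ψ₀ j)) : ℂ) * hexCenter (q (φ (ψ₀ j)))) atTop (𝓝 g₀) :=
    hlim₂.comp hψ₃.tendsto_atTop
  have hgate1 : Tendsto (fun j => (δ (φ (ψ₀ j)) : ℂ) * hexCenter (q' (φ (ψ₀ j)))) atTop (𝓝 g₁) := hlim₃
  -- PINNING (twin piece)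
  have hup0 : ∀ j, hexCenter ((((q (φ (ψ₀ j))).1), 0) : HexVertex) = hexCenter (q (φ (ψ₀ j))) :=
    fun j => congrArg hexCenter ((hfacts (φ (ψ₀ j))).1.1).symm
  have hup1 : ∀ j, hexCenter ((((q' (φ (ψ₀ j))).1), 0) : HexVertex) = hexCenter (q' (φ (ψ₀ j))) :=
    fun j => congrArg hexCenter ((hfacts (φ (ψ₀ j))).2.1).symm
  obtain ⟨x, τ, hτ, him0, hpin0, hpin1, hab0, hab1⟩ := stub_carvedReduction_pinning (fun j => δ (φ (ψ₀ j)))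
    (fun j => (q (φ (ψ₀ j))).1) (fun j => (q' (φ (ψ₀ j))).1) g₀ g₁ hspos hs0'
    (by simp_rw [hup0]; exact hgate0) (by simp_rw [hup1]; exact hgate1)
  -- the pinned gate centre is the original centre minus `τ_j`
  have hpinc : ∀ (y z : Site 2) (s : ℝ), (s : ℂ) * hexCenter ((y - z, 0) : HexVertex) =
      (s : ℂ) * hexCenter ((y, 0) : HexVertex) - (s : ℂ) * triEmbed z := by
    intro y z s
    have := hexCenter_translate z ((y - z, 0) : HexVertex)
    simp only [add_sub_cancel] at this
    rw [this]; ring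
  have hqτ : Tendsto (fun j => (δ (φ (ψ₀ j)) : ℂ) * hexCenter (q (φ (ψ₀ j))) - (δ (φ (ψ₀ j)) : ℂ) * triEmbed (x j))
      atTop (𝓝 (g₀ - τ)) := by
    have := hpin0; simp_rw [hpinc, hup0] at this; exact this
  have hq'τ : Tendsto (fun j => (δ (φ (ψ₀ j)) : ℂ) * hexCenter (q' (φ (ψ₀ j))) - (δ (φ (ψ₀ j)) : ℂ) * triEmbed (x j))
      atTop (𝓝 (g₁ - τ)) := by
    have := hpin1; simp_rw [hpinc, hup1] at this; exact this
  -- eventually the pinned gates are `ρ/2`-close to the limit gate points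
  have hclose : ∀ᶠ j in atTop,
      dist ((δ (φ (ψ₀ j)) : ℂ) * hexCenter (q (φ (ψ₀ j))) - (δ (φ (ψ₀ j)) : ℂ) * triEmbed (x j)) (g₀ - τ) < ρ / 2 ∧
      dist ((δ (φ (ψ₀ j)) : ℂ) * hexCenter (q' (φ (ψ₀ j))) - (δ (φ (ψ₀ j)) : ℂ) * triEmbed (x j)) (g₁ - τ) < ρ / 2 :=
    ((tendsto_iff_dist_tendsto_zero.1 hqτ).eventually (gt_mem_nhds (by positivity))).and
      ((tendsto_iff_dist_tendsto_zero.1 hq'τ).eventually (gt_mem_nhds (by positivity)))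
  refine ⟨ψ₀, x, τ, g₀ - τ, g₁ - τ, hψ₀, hanti, hspos, hs, hτ, fun k => ?_, fun k => ?_, hpin0, hpin1,
    fun j => by rw [him0]; exact hab0 j, hab1, by rw [sub_add_cancel]; exact hgate0,
    by rw [sub_add_cancel]; exact hgate1, ?_, ?_, ?_, fun k => (hfacts k).1.2.1, ?_⟩
  · rw [(hfacts k).1.1]
  · rw [(hfacts k).2.1]
  · filter_upwards [hκ.eventually hexactU, hclose] with j hexj hcl v hv
    refine hexj.1 v ?_
    rw [mem_ball] at hv ⊢
    calc dist ((δ (φ (ψ₀ j)) : ℂ) * hexCenter v) ((δ (φ (ψ₀ j)) : ℂ) * hexCenter (q (φ (ψ₀ j))))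
        = dist ((δ (φ (ψ₀ j)) : ℂ) * hexCenter v - (δ (φ (ψ₀ j)) : ℂ) * triEmbed (x j))
            ((δ (φ (ψ₀ j)) : ℂ) * hexCenter (q (φ (ψ₀ j))) - (δ (φ (ψ₀ j)) : ℂ) * triEmbed (x j)) := by
          rw [dist_sub_right]
      _ ≤ dist ((δ (φ (ψ₀ j)) : ℂ) * hexCenter v - (δ (φ (ψ₀ j)) : ℂ) * triEmbed (x j)) (g₀ - τ) +
          dist (g₀ - τ) ((δ (φ (ψ₀ j)) : ℂ) * hexCenter (q (φ (ψ₀ j))) - (δ (φ (ψ₀ j)) : ℂ) * triEmbed (x j)) :=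
          dist_triangle _ _ _
      _ < ρ / 2 + ρ / 2 := by rw [dist_comm (g₀ - τ)]; exact add_lt_add hv hcl.1
      _ = ρ := by ring
  · filter_upwards [hκ.eventually hexactU, hclose] with j hexj hcl v hv
    refine hexj.2 v ?_
    rw [mem_ball] at hv ⊢
    calc dist ((δ (φ (ψ₀ j)) : ℂ) * hexCenter v) ((δ (φ (ψ₀ j)) : ℂ) * hexCenter (q' (φ (ψ₀ j))))
        = dist ((δ (φ (ψ₀ j)) : ℂ) * hexCenter v - (δ (φ (ψ₀ j)) : ℂ) * triEmbed (x j))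
            ((δ (φ (ψ₀ j)) : ℂ) * hexCenter (q' (φ (ψ₀ j))) - (δ (φ (ψ₀ j)) : ℂ) * triEmbed (x j)) := by
          rw [dist_sub_right]
      _ ≤ dist ((δ (φ (ψ₀ j)) : ℂ) * hexCenter v - (δ (φ (ψ₀ j)) : ℂ) * triEmbed (x j)) (g₁ - τ) +
          dist (g₁ - τ) ((δ (φ (ψ₀ j)) : ℂ) * hexCenter (q' (φ (ψ₀ j))) - (δ (φ (ψ₀ j)) : ℂ) * triEmbed (x j)) :=
          dist_triangle _ _ _
      _ < ρ / 2 + ρ / 2 := by rw [dist_comm (g₁ - τ)]; exact add_lt_add hv hcl.2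
      _ = ρ := by ring
  · filter_upwards [hclose] with j hcl
    obtain ⟨⟨-, -, -, hwin, -⟩, -, -, hwin', -⟩ := hfacts (φ (ψ₀ j))
    constructor
    · refine (closedBall_subset_closedBall' ?_).trans hwin
      have h := hcl.1
      rw [dist_comm, dist_eq_norm] at h
      have e : g₀ - τ - ((δ (φ (ψ₀ j)) : ℂ) * hexCenter (q (φ (ψ₀ j))) - (δ (φ (ψ₀ j)) : ℂ) * triEmbed (x j)) =
          g₀ - τ + (δ (φ (ψ₀ j)) : ℂ) * triEmbed (x j) - (δ (φ (ψ₀ j)) : ℂ) * hexCenter (q (φ (ψ₀ j))) := by ring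
      rw [e, ← dist_eq_norm] at h
      linarith [h.le]
    · refine (closedBall_subset_closedBall' ?_).trans hwin'
      have h := hcl.2
      rw [dist_comm, dist_eq_norm] at h
      have e : g₁ - τ - ((δ (φ (ψ₀ j)) : ℂ) * hexCenter (q' (φ (ψ₀ j))) - (δ (φ (ψ₀ j)) : ℂ) * triEmbed (x j)) =
          g₁ - τ + (δ (φ (ψ₀ j)) : ℂ) * triEmbed (x j) - (δ (φ (ψ₀ j)) : ℂ) * hexCenter (q' (φ (ψ₀ j))) := by ring
      rw [e, ← dist_eq_norm] at h
      linarith [h.le]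
  · exact hprob R hRR₁ ρ N δ S T n n' q q' hδ (fun k => ⟨(hfam k).1, (hfam k).2.1⟩) fun k => by
      obtain ⟨γ, m, p, m', p', h1, h2, -⟩ := hgates k
      exact ⟨γ, m, p, m', p', h1, h2⟩

end Summit.CriticalPhenomena.SAWScalingLimit.Theorems.ObservableToSLE.TypeLadder

end
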